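import Summits.ValiantsHypothesis.ValiantsHypothesis.Theses.FeketeSOS
import Literature.Uncategorized.FeketeNoSparseSplitWithoutLegendre

/-!
# `FeketeNoSparseSplit` (crux stmt-ValiantsHypothesis-3997): the VALUES of `χ_p` are load-bearing

Negative-side load-bearing analysis (cdisprove, refuter-cdisprove-stmt-ValiantsHypothesis-3997-0), PROVED:
the crux `FeketeSOS.FeketeNoSparseSplit` with the Legendre symbol replaced by an arbitrary unimodular
coefficient sequence `ε` on `[1, p-1]` (same support, same prime lengths, same exponent `1/2 + δ`) is
FALSE.  The refuted variant `FeketeNoSparseSplitWithoutLegendre` and its refutation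
`not_feketeNoSparseSplitWithoutLegendre` live in `Literature/Uncategorized/FeketeNoSparseSplitWithoutLegendre.lean`
(the gate relocated the `def … : Prop` there at accept time, p74092; the proof followed it); this file is the
crux-side record under `Theorems/FeketeNoSparseSplit/Negative/`.
Witness for every prime `p`, `n = p - 1`, `a = ⌊√n⌋ + 1`, `t = ⌊n/a⌋`, `ω = e^{2πi/3}`:
`X·(1 + X + ⋯ + X^{a-1}) · (Σ_{j<t} X^{aj} + ω·X^{n-a})` has support exactly `[1, p-1]`, coefficients in
`{1, 1+ω, ω}` (all of modulus `1`) and support-sum `≤ a + t + 1 ≤ 2√p + 2 < p^{1/2+δ}` as soon as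
`p^δ ≥ 4`.  So "support `[1,p-1]` + unimodular coefficients + `p` prime" carries only the counting
exponent `1/2`; any proof of the crux must use the arithmetic of the values `χ_p(m)` (the line
`cyclic-valuation-dichotomy` uses them through Euler's criterion mod `p`).  No new facts.
-/

namespace Summit.ValiantsHypothesis.Theorems.FeketeNoSparseSplit.Negative

/-- **Any proof of the crux must use the values of `χ_p`** (not only `|χ_p(m)| = 1`, the support
`[1, p-1]` and the primality of `p`): the unimodular analogue `FeketeNoSparseSplitWithoutLegendre` is
false (digit tilings with a cube-root-of-unity patch, support-sum `≤ 2√p + 2`). [folklore] -/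
theorem feketeNoSparseSplit_false_without_legendre :
    ¬ Literature.Uncategorized.FeketeNoSparseSplitWithoutLegendre :=
  Literature.Uncategorized.not_feketeNoSparseSplitWithoutLegendre

end Summit.ValiantsHypothesis.Theorems.FeketeNoSparseSplit.Negative
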